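/-
Copyright (c) 2026 the pub-hodgecm-mathlib formalisation cell (harness21).  Prover seat hodgecm-mathlib-K2E4-p15 (g2), Track B ∕ K2-LIT
(build stream 29), h413 = `stmt-HodgeConjecture-24833`, line `K2_E4_SingularTransferKappaSign`, socket module «ArchLimitConstant» ED. 5, pool item #10♯
`sig_K2E4ExplicitArchConstantPhaseSigned` (K2E4-plan (g0) 2026-09-03T22:12:33Z) — part 1 of 2: the archimedean κ-sign at the semiregular pair.  2026-09-03.
-/
import Literature.NumberTheory.Rogawski1990.ArchCanonicalTransferFactor                  -- ★ `archCanonicalDelta_of_isArchNormPair`, `archKappaSignAt` (`κ‴_w`), `Δ‴_∞ = τ · D · Π κ‴`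
import Literature.NumberTheory.Rogawski1990.ExplicitFactorProductFormulaGHRegularParts   -- ★ (P-α) `archKappaSignAt_eq_sign_re_embedding_columnFormValue'` (κ‴_w reads a column of the projector)
import Literature.NumberTheory.Rogawski1990.ExplicitFactorRationalLocalisation           -- ★ `archEigenlineProjector_rationalArch`, `archWeylRatio_rationalArch`
import Summits.HodgeConjecture.HodgeConjecture.Theorems.K2E4SingularPairWeylKappaValues        -- ★ p854878 (this base, g0): `globalProjector_singularPair`, `sum_sum_eq_hermForm`, `hermForm_smul_self`, `eval_charpoly_singularPair_ne_zero`
import Summits.HodgeConjecture.HodgeConjecture.Theorems.K2E4SingularPairEigenplane            -- ★ p854875 (K2E4-p08): `exists_pinned_diagonal_frame`, `det_ne_zero_of_anisotropic_herm`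
import Summits.HodgeConjecture.HodgeConjecture.Theorems.K2E4KottwitzSignParityReadings        -- ★ (K2E4-p18): `eigenplane_anisotropic_arch_iff`, `ncard_setOf_infinitePlace_eq_card_filter`
import Summits.HodgeConjecture.HodgeConjecture.Theorems.K2E4ExplicitArchConstantPhaseFactor   -- ★ p854856 (K2E4-p10): `isArchNormPair_of_semiregular`, `conj_archTau_mul_archTau_sq`, `archCanonicalDelta_ne_zero_of_semiregular`
import HarnessLib

/-!
# The archimedean κ-sign AT THE SEMIREGULAR PAIR: `κ‴_w(γ_H ⊗ 1, γ₀ ⊗ 1)` reads the `e₂`-eigenline, and `κ‴_w · e_w(γ₀) = −sgn σ_w(det H′)` — so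
# `Δ‴_∞(γ_H ⊗ 1, γ₀ ⊗ 1) = τ_∞ · D_∞ · ε(H′) · (−1)^{#{w : W₂(γ₀) ⊗_w ℂ definite}}` with `ε(H′) = Π_w (−sgn σ_w det H′)` (Rogawski 1990 §4.9, §8.2, §14.6)

Cell `hodgecm-mathlib`, crux H413 = `stmt-HodgeConjecture-24833`, route of record `HCCMUnconditional`; Track B «K2-LIT» (build stream 29), line
`Cruxes/H413/Lines/K2_E4_SingularTransferKappaSign.lean`, socket module `…SigsArchLimitConstant` ED. 5 (sha16 38e88d159f756d7c), pool item #10♯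
`sig_K2E4ExplicitArchConstantPhaseSigned` :316.  THEOREMS ONLY (no `def`, no instance, no notation, no `sorry`); lane `--supports stmt-HodgeConjecture-24833 --as helper`.
Author K2E4-p15 (g2).  PART 1 of 2 — the frame-free algebra at the pair (the archimedean twin of ★ p854878 `K2E4SingularPairWeylKappaValues` §3); part 2 =
`Theorems/K2E4ExplicitArchConstantPhaseSignedOfSignLaw.lean` (socket #10♯ ⟺ the signed socket #9, under the socket frame verbatim).

THE MATHEMATICS.  Let `γ₀ ∈ U(H′)(L)` be print's semiregular element (`(γ₀ − e₁)(γ₀ − e₂) = 0`, `charpoly γ₀ = (X − e₁)²(X − e₂)`, `e₁ ≠ e₂`, non-central), `γ_H = (e₁·1₂, e₂)`,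
and `(P, d)` the pinned diagonal frame of ★ `exists_pinned_diagonal_frame` (`ᵗ(cP) H′ P = diag(d₀, d₁, d₂)`, `γ₀ P = P·diag(e₁, e₁, e₂)`, `dᵢ ∈ L⁺ ∖ {0}`): the first two
columns of `P` span the `e₁`-eigenplane `W₂(γ₀)`, the third the `e₂`-eigenline `W₁(γ₀)`.  At a complex place `w` (embedding `σ_w`):
* (§1–§2) `κ‴_w(γ_H ⊗ 1, γ₀ ⊗ 1) = sgn σ_w(d₂)` — ★ `archKappaSignAt` (`sgn Re tr(P_wᴴ w(H′) P_w)`) reads the sign of `w(H′)` on the `e₂`-EIGENLINE: the global projector is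
  `(e₂ − e₁)(γ₀ − e₁)` (★ `globalProjector_singularPair`), its columns are multiples of `P·e₂`, and `⟨P e₂, P e₂⟩_{H′} = d₂`;
* (§2) `W₂(γ₀) ⊗_w ℂ` is definite iff `0 < σ_w(d₀ d₁)` (★ `eigenplane_anisotropic_arch_iff`), i.e. the Kottwitz sign of the centraliser is `e_w(γ₀) = −sgn σ_w(d₀ d₁)`
  («`e(γ₀′) = −1`» for the compact centraliser, p. 117);
* (§2) `sgn σ_w(det H′) = sgn σ_w(d₀) sgn σ_w(d₁) sgn σ_w(d₂)` (`c(det P)·det P·det H′ = d₀ d₁ d₂`).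
Hence the PER-PLACE LAW `κ‴_w · e_w = sgn(d₂)·(−sgn(d₀d₁)) = −sgn σ_w(det H′)`: the sheet of `γ₀` at `w` moves `κ‴_w` and `e_w` TOGETHER — this is print's «the constant in the
limit formula for `H′` differs by a sign from that in the limit formula for `H`» [Prop. 8.2.1 proof p. 119] read against the sign `κ‴_w` inside `Δ‴_∞`.  Globally (§3), with
  `ε(H′) := Π_{w complex} (−sgn σ_w(det H′)) = (−1)^{[L⁺:ℚ]} · sgn N_{L⁺∕ℚ}(det H′) ∈ {±1}`   (a constant of `H′` ALONE),
`ε(H′) · Π_w κ‴_w(γ_H ⊗ 1, γ₀ ⊗ 1) = (−1)^{#{w ∣ ∞ : W₂(γ₀) ⊗_w ℂ definite}}` (the sign of socket #10♯), and `Δ‴_∞(γ_H ⊗ 1, γ₀ ⊗ 1) = τ_∞(γ_H ⊗ 1) · D_∞ · Π_w κ‴_w` with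
`D_∞ = Π_w |σ_w((e₂ − e₁)²)| > 0`, `conj τ_∞ · τ_∞ = 1` (★ `archCanonicalDelta_of_isArchNormPair`).
[Rogawski1990, §4.9 p. 55 (`τ`, `D_{G∕H}`, «`|τ(γ)| = 1`»); §14.6 p. 242 (`κ = ±1`, `c = ±1`); §8.2 p. 117 (`e(γ₀′) = −1`), Prop. 8.2.1 proof p. 119 L32 («differs by a sign»),
L36 («τ(γ)|A₁(γ)A₂(γ)|»); §3.8 Prop. 3.8.1 pp. 30–31; §3.5 Prop. 3.5.2 (c) pp. 25–26] [Kottwitz1983 §1] [LanglandsShelstad1987 §2].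

* §1 `sub_smul_one_apply_eq_of_frame` (`(γ₀ − e₁)ᵢⱼ = Pᵢ₂·(e₂ − e₁)(P⁻¹)₂ⱼ`), `hermForm_col_two_of_frame` (`⟨P e₂, P e₂⟩ = d₂`), `sign_re_embedding_norm_mul`.
* §2 **`archKappaSignAt_singularPair_eq_sign_eigenline`** (frame-free: `κ‴_w = sgn Re σ_w⟨p, p⟩_{H′}` for any non-zero column `p` of `γ₀ − e₁`),
  `archKappaSignAt_singularPair_eq_sign_of_frame` (`= sgn σ_w d₂`), `sign_re_embedding_det_of_frame`, **`neg_sign_det_mul_archKappaSignAt_eq_ite_of_frame`** (the per-place law).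
* §3 **`prod_neg_sign_det_mul_prod_archKappaSignAt_eq_neg_one_pow_ncard`** (the global law, in the spelling of socket #10♯'s sign), `archCanonicalDelta_singularPair_eq`,
  `archWeylRatio_singularPair_pos`, `conj_archTau_mul_archTau_singularPair`.

HONEST LABEL.  Count-neutral helper (`--supports 24833 --as helper`), pure algebra over ★ definitions; consumed by part 2.  HC_CM is proved only modulo the 7 printed citations
(2 remaining named inputs: hLiu418 = stmt-HodgeConjecture-24832, h413 = stmt-HodgeConjecture-24833) until rung 0 closes.

## References
* [Rogawski1990] J. D. Rogawski, *Automorphic Representations of Unitary Groups in Three Variables*, Ann. of Math. Stud. 123 (1990): §4.9 p. 55; §14.6 p. 242; §8.2 p. 117 and Prop. 8.2.1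
  proof pp. 118–119 (held e-text `book:rogawski1990…` p0118 L3, L28–L36); §3.8 Prop. 3.8.1 pp. 30–31; §3.5 Prop. 3.5.2 (c) pp. 25–26; §4.1 (4.1.2) p. 39.
* [Kottwitz1983] R. E. Kottwitz, *Sign changes in harmonic analysis on reductive groups*, Trans. Amer. Math. Soc. 278 (1983), 289–297, §1.
* [LanglandsShelstad1987] R. P. Langlands, D. Shelstad, *On the definition of transfer factors*, Math. Ann. 278 (1987), §2, §6.4.
-/

set_option autoImplicit false
set_option linter.dupNamespace false

noncomputable section

open NumberField NumberField.InfinitePlace IsDedekindDomain Matrix Polynomial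
open Literature.NumberTheory.Rogawski1990 Literature.NumberTheory.Automorphic Literature.NumberTheory.GaloisRepresentations
open Literature.AlgebraicGeometry.ShimuraVarieties (unitaryGroup hermForm)
open Summit.HodgeConjecture.HodgeConjecture.Cruxes.H413.K2E4SingularPairWeylKappaValues (globalProjector_singularPair sum_sum_eq_hermForm hermForm_smul_self
  eval_charpoly_singularPair_ne_zero)
open Summit.HodgeConjecture.HodgeConjecture.Cruxes.H413.K2E4SingularPairEigenplane (exists_pinned_diagonal_frame det_ne_zero_of_anisotropic_herm)
open Summit.HodgeConjecture.HodgeConjecture.Cruxes.H413.K2E4KottwitzSignParityReadings (eigenplane_anisotropic_arch_iff ncard_setOf_infinitePlace_eq_card_filter)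
open Summit.HodgeConjecture.HodgeConjecture.Cruxes.H413.K2E4ExplicitArchConstantPhaseFactor (isArchNormPair_of_semiregular conj_archTau_mul_archTau_sq
  archCanonicalDelta_ne_zero_of_semiregular)
open scoped MatrixGroups ComplexConjugate Classical

namespace Summit.HodgeConjecture.HodgeConjecture.Cruxes.H413.K2E4SingularPairArchKappaSign

/-! ## §1 Frame algebra over `L`: the columns of `γ₀ − e₁` are multiples of the `e₂`-eigenvector `P e₂`, whose `H′`-length is `d₂` -/

section FrameAlgebra

variable (L : Type) [Field L] [NumberField L] [IsCMField L] (H' : Matrix (Fin 3) (Fin 3) L)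
  (γ₀ : (UnitaryGroup.cmDatum L 3 H').Rational) {e₁ e₂ : L}
  {P : GL (Fin 3) L} {d : Fin 3 → L}
  (hHP : (((P : Matrix (Fin 3) (Fin 3) L)).map (cmConjRingHom L))ᵀ * H' * (P : Matrix (Fin 3) (Fin 3) L) = Matrix.diagonal d)
  (hγP : ((((γ₀ : unitaryGroup (cmConjRingHom L) H').val : GL (Fin 3) L) : Matrix (Fin 3) (Fin 3) L)) * (P : Matrix (Fin 3) (Fin 3) L) =
    (P : Matrix (Fin 3) (Fin 3) L) * Matrix.diagonal ![e₁, e₁, e₂])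

include hγP in
/-- **In the pinned frame `γ₀ − e₁ = P · diag(0, 0, e₂ − e₁) · P⁻¹`**, entrywise: `(γ₀ − e₁)ᵢⱼ = Pᵢ₂ · ((e₂ − e₁) (P⁻¹)₂ⱼ)` — every column of `γ₀ − e₁` is a multiple of the
third column `P e₂` of the frame (a vector spanning the `e₂`-eigenline `W₁(γ₀) = im(γ₀ − e₁)`). [cite: Rogawski1990, §3.8 Prop. 3.8.1 (a) p. 30] -/
theorem sub_smul_one_apply_eq_of_frame (i j : Fin 3) :
    ((((γ₀ : unitaryGroup (cmConjRingHom L) H').val : GL (Fin 3) L) : Matrix (Fin 3) (Fin 3) L) - e₁ • (1 : Matrix (Fin 3) (Fin 3) L)) i j =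
      (P : Matrix (Fin 3) (Fin 3) L) i 2 * ((e₂ - e₁) * ((P⁻¹ : GL (Fin 3) L) : Matrix (Fin 3) (Fin 3) L) 2 j) := by
  set X := (((γ₀ : unitaryGroup (cmConjRingHom L) H').val : GL (Fin 3) L) : Matrix (Fin 3) (Fin 3) L) with hX
  have hD : Matrix.diagonal ![e₁, e₁, e₂] - e₁ • (1 : Matrix (Fin 3) (Fin 3) L) = Matrix.diagonal ![0, 0, e₂ - e₁] := by
    rw [smul_one_eq_diagonal, Matrix.diagonal_sub]
    congr 1
    funext k
    fin_cases k <;> simp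
  have hmat : (X - e₁ • (1 : Matrix (Fin 3) (Fin 3) L)) * (P : Matrix (Fin 3) (Fin 3) L) =
      (P : Matrix (Fin 3) (Fin 3) L) * Matrix.diagonal ![0, 0, e₂ - e₁] := by
    rw [Matrix.sub_mul, hγP, Matrix.smul_mul, Matrix.one_mul, ← hD, Matrix.mul_sub, Matrix.mul_smul, Matrix.mul_one]
  have hconj : X - e₁ • (1 : Matrix (Fin 3) (Fin 3) L) =
      (P : Matrix (Fin 3) (Fin 3) L) * Matrix.diagonal ![0, 0, e₂ - e₁] * ((P⁻¹ : GL (Fin 3) L) : Matrix (Fin 3) (Fin 3) L) := by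
    rw [← hmat, Matrix.mul_assoc, ← Units.val_mul, mul_inv_cancel, Units.val_one, Matrix.mul_one]
  rw [hconj, Matrix.mul_apply, Fin.sum_univ_three, Matrix.mul_diagonal, Matrix.mul_diagonal, Matrix.mul_diagonal]
  have h0 : (![0, 0, e₂ - e₁] : Fin 3 → L) 0 = 0 := rfl
  have h1 : (![0, 0, e₂ - e₁] : Fin 3 → L) 1 = 0 := rfl
  have h2 : (![0, 0, e₂ - e₁] : Fin 3 → L) 2 = e₂ - e₁ := rfl
  rw [h0, h1, h2, mul_zero, zero_mul, mul_zero, zero_mul, zero_add, zero_add]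
  ring

include hHP in
/-- **`⟨P e₂, P e₂⟩_{H′} = d₂`**: the `(2,2)` entry of `ᵗ(cP) H′ P = diag(d)`. [cite: Rogawski1990, §3.8 Prop. 3.8.1 (a) p. 30; §1.9 p. 11] -/
theorem hermForm_col_two_of_frame :
    hermForm (cmConjRingHom L) H' (fun i => (P : Matrix (Fin 3) (Fin 3) L) i 2) (fun i => (P : Matrix (Fin 3) (Fin 3) L) i 2) = d 2 := by
  have h22 := congrArg (fun M : Matrix (Fin 3) (Fin 3) L => M 2 2) hHP
  simp only [Matrix.mul_apply, Matrix.transpose_apply, Matrix.map_apply, Matrix.diagonal_apply_eq, Finset.sum_mul] at h22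
  rw [Finset.sum_comm] at h22
  rw [← sum_sum_eq_hermForm]
  simp only [← cmConjRingHom_apply]
  exact h22

/-- For `a ≠ 0` the factor `c(a)·a` does not change the sign at a complex place: `sgn Re σ(c(a) a t) = sgn Re σ(t)` (`σ(c(a) a) = |σ a|² > 0`).
[cite: Rogawski1990, §3.5 Prop. 3.5.2 (c) pp. 25–26] -/
theorem sign_re_embedding_norm_mul (φ : L →+* ℂ) {a : L} (ha : a ≠ 0) (t : L) :
    SignType.sign ((φ (cmConjRingHom L a * a * t)).re) = SignType.sign ((φ t).re) := by
  rw [map_mul, map_mul, embedding_cmConjRingHom, ← Complex.normSq_eq_conj_mul_self, Complex.re_ofReal_mul, _root_.sign_mul,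
    sign_pos (Complex.normSq_pos.2 ((map_ne_zero φ).2 ha)), one_mul]

end FrameAlgebra

/-! ## §2 The complex places: `κ‴_w` on the `e₂`-eigenline, the eigenplane test, `det H′`, and the per-place law `κ‴_w · e_w = −sgn σ_w(det H′)` -/

section Pair

variable (L : Type) [Field L] [NumberField L] [IsCMField L] (H' : Matrix (Fin 3) (Fin 3) L)
  (hherm : (H'.map (cmConjRingHom L)).transpose = H')
  (hanis : ∀ x : Fin 3 → L, hermForm (cmConjRingHom L) H' x x = 0 → x = 0)
  (γ₀ : (UnitaryGroup.cmDatum L 3 H').Rational) {e₁ e₂ : L} (he : e₁ ≠ e₂)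
  (hsplit : ((((γ₀ : unitaryGroup (cmConjRingHom L) H').val : GL (Fin 3) L) : Matrix (Fin 3) (Fin 3) L) - e₁ • (1 : Matrix (Fin 3) (Fin 3) L)) *
      ((((γ₀ : unitaryGroup (cmConjRingHom L) H').val : GL (Fin 3) L) : Matrix (Fin 3) (Fin 3) L) - e₂ • (1 : Matrix (Fin 3) (Fin 3) L)) = 0)
  (hnc : ¬ ∃ ζ : L, (((γ₀ : unitaryGroup (cmConjRingHom L) H').val : GL (Fin 3) L) : Matrix (Fin 3) (Fin 3) L) = ζ • (1 : Matrix (Fin 3) (Fin 3) L))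
  (hχ : (((γ₀ : unitaryGroup (cmConjRingHom L) H').val : GL (Fin 3) L) : Matrix (Fin 3) (Fin 3) L).charpoly =
    (Polynomial.X - Polynomial.C e₁) ^ 2 * (Polynomial.X - Polynomial.C e₂))
  (γH : (UnitaryGroup.cmDatum L 2 (Matrix.of fun i j : Fin 2 => if i.val + j.val + 1 = 2 then (1 : L) else 0)).Rational ×
    (UnitaryGroup.cmDatum L 1 (Matrix.of fun i j : Fin 1 => if i.val + j.val + 1 = 1 then (1 : L) else 0)).Rational)
  (h1 : (((γH.1 : unitaryGroup (cmConjRingHom L) (Matrix.of fun i j : Fin 2 => if i.val + j.val + 1 = 2 then (1 : L) else 0)).val : GL (Fin 2) L) :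
      Matrix (Fin 2) (Fin 2) L) = e₁ • (1 : Matrix (Fin 2) (Fin 2) L))
  (h2 : (((γH.2 : unitaryGroup (cmConjRingHom L) (Matrix.of fun i j : Fin 1 => if i.val + j.val + 1 = 1 then (1 : L) else 0)).val : GL (Fin 1) L) :
      Matrix (Fin 1) (Fin 1) L) 0 0 = e₂)
  (W : {w : InfinitePlace L // IsComplex w})

include he hsplit hχ h1 h2 in
/-- **`κ‴_w(γ_H ⊗ 1, γ₀ ⊗ 1)` READS THE SIGN OF `w(H′)` ON THE `e₂`-EIGENLINE** (frame-free): for ANY non-zero column `p = (γ₀ − e₁)·e_j` (a rational vector spanning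
`W₁(γ₀) = ker(γ₀ − e₂) = im(γ₀ − e₁)`), `κ‴_w = sgn Re σ_w ⟨p, p⟩_{H′}` — ★ (P-α) `archKappaSignAt_eq_sign_re_embedding_columnFormValue'` on the global projector
`(e₂ − e₁)(γ₀ − e₁)` (★ `globalProjector_singularPair`, ★ `archEigenlineProjector_rationalArch`), the global scalar `(e₂ − e₁)` dropped by `sign_re_embedding_norm_mul`.
The archimedean twin of ★ `finKappaAt_singularPair_eq_ite_eigenline`. [cite: Rogawski1990, §14.6 p. 242; §3.5 Prop. 3.5.2 (c) pp. 25–26] [cite: LanglandsShelstad1987, §2] -/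
theorem archKappaSignAt_singularPair_eq_sign_eigenline {j : Fin 3}
    (hj : ∃ i : Fin 3, ((((γ₀ : unitaryGroup (cmConjRingHom L) H').val : GL (Fin 3) L) : Matrix (Fin 3) (Fin 3) L) - e₁ • (1 : Matrix (Fin 3) (Fin 3) L)) i j ≠ 0) :
    archKappaSignAt L H' (rationalArch L γH) W (cmRationalToArch L 3 H' γ₀) =
      (SignType.sign ((W.1.embedding (hermForm (cmConjRingHom L) H'
        (fun i => ((((γ₀ : unitaryGroup (cmConjRingHom L) H').val : GL (Fin 3) L) : Matrix (Fin 3) (Fin 3) L) - e₁ • (1 : Matrix (Fin 3) (Fin 3) L)) i j)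
        (fun i => ((((γ₀ : unitaryGroup (cmConjRingHom L) H').val : GL (Fin 3) L) : Matrix (Fin 3) (Fin 3) L) - e₁ • (1 : Matrix (Fin 3) (Fin 3) L)) i j))).re) : ℤ) := by
  set X := (((γ₀ : unitaryGroup (cmConjRingHom L) H').val : GL (Fin 3) L) : Matrix (Fin 3) (Fin 3) L) with hX
  have hp : IsArchNormPair L H' (rationalArch L γH) (cmRationalToArch L 3 H' γ₀) := isArchNormPair_of_semiregular L H' he hsplit hχ h1 h2
  have hP : archEigenlineProjector L H' (rationalArch L γH) W (cmRationalToArch L 3 H' γ₀) =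
      ((e₂ - e₁) • (X - e₁ • (1 : Matrix (Fin 3) (Fin 3) L))).map W.1.embedding := by
    rw [archEigenlineProjector_rationalArch, globalProjector_singularPair L H' γ₀ hsplit γH h1]
  obtain ⟨i, hi⟩ := hj
  have hj₀ : ∃ i : Fin 3, ((e₂ - e₁) • (X - e₁ • (1 : Matrix (Fin 3) (Fin 3) L))) i j ≠ 0 :=
    ⟨i, by rw [Matrix.smul_apply, smul_eq_mul]; exact mul_ne_zero (sub_ne_zero.2 he.symm) hi⟩
  rw [archKappaSignAt_eq_sign_re_embedding_columnFormValue' L H' (rationalArch L γH) (cmRationalToArch L 3 H' γ₀) W hp hP hj₀, sum_sum_eq_hermForm]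
  have hq : (fun i => ((e₂ - e₁) • (X - e₁ • (1 : Matrix (Fin 3) (Fin 3) L))) i j) = (e₂ - e₁) • (fun i => (X - e₁ • (1 : Matrix (Fin 3) (Fin 3) L)) i j) := rfl
  rw [hq, hermForm_smul_self, sign_re_embedding_norm_mul L W.1.embedding (sub_ne_zero.2 he.symm)]

variable {P : GL (Fin 3) L} {d : Fin 3 → L}
  (hdσ : ∀ i, cmConjRingHom L (d i) = d i) (hd0 : ∀ i, d i ≠ 0)
  (hHP : (((P : Matrix (Fin 3) (Fin 3) L)).map (cmConjRingHom L))ᵀ * H' * (P : Matrix (Fin 3) (Fin 3) L) = Matrix.diagonal d)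
  (hγP : ((((γ₀ : unitaryGroup (cmConjRingHom L) H').val : GL (Fin 3) L) : Matrix (Fin 3) (Fin 3) L)) * (P : Matrix (Fin 3) (Fin 3) L) =
    (P : Matrix (Fin 3) (Fin 3) L) * Matrix.diagonal ![e₁, e₁, e₂])

include hnc in
/-- A semiregular non-central `γ₀` has a non-zero entry of `γ₀ − e₁` (bookkeeping). [cite: Rogawski1990, §3.8 p. 30] -/
theorem exists_sub_smul_one_apply_ne_zero :
    ∃ i j : Fin 3, ((((γ₀ : unitaryGroup (cmConjRingHom L) H').val : GL (Fin 3) L) : Matrix (Fin 3) (Fin 3) L) - e₁ • (1 : Matrix (Fin 3) (Fin 3) L)) i j ≠ 0 := by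
  by_contra h
  push Not at h
  exact hnc ⟨e₁, sub_eq_zero.1 (Matrix.ext fun i j => h i j)⟩

include he hsplit hnc hχ h1 h2 hHP hγP in
/-- **In the pinned frame `κ‴_w(γ_H ⊗ 1, γ₀ ⊗ 1) = sgn σ_w(d₂)`** — the sign of `w(H′)` on the `e₂`-eigenline `L·(P e₂)` (§1 + the eigenline reading).
[cite: Rogawski1990, §14.6 p. 242; §8.2 p. 117] -/
theorem archKappaSignAt_singularPair_eq_sign_of_frame :
    archKappaSignAt L H' (rationalArch L γH) W (cmRationalToArch L 3 H' γ₀) = (SignType.sign ((W.1.embedding (d 2)).re) : ℤ) := by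
  obtain ⟨i, j, hij⟩ := exists_sub_smul_one_apply_ne_zero L H' γ₀ hnc
  rw [archKappaSignAt_singularPair_eq_sign_eigenline L H' γ₀ he hsplit hχ γH h1 h2 W ⟨i, hij⟩]
  set lam : L := (e₂ - e₁) * ((P⁻¹ : GL (Fin 3) L) : Matrix (Fin 3) (Fin 3) L) 2 j with hlam
  have hcol : (fun i => ((((γ₀ : unitaryGroup (cmConjRingHom L) H').val : GL (Fin 3) L) : Matrix (Fin 3) (Fin 3) L) - e₁ • (1 : Matrix (Fin 3) (Fin 3) L)) i j) =
      lam • (fun i => (P : Matrix (Fin 3) (Fin 3) L) i 2) := by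
    funext k
    rw [sub_smul_one_apply_eq_of_frame L H' γ₀ hγP k j, Pi.smul_apply, smul_eq_mul, mul_comm]
  have hlam0 : lam ≠ 0 := by
    intro h0
    rw [sub_smul_one_apply_eq_of_frame L H' γ₀ hγP i j, ← hlam, h0, mul_zero] at hij
    exact hij rfl
  rw [hcol, hermForm_smul_self, hermForm_col_two_of_frame L H' hHP]
  exact congrArg _ (sign_re_embedding_norm_mul L W.1.embedding hlam0 (d 2))

include hdσ in
/-- The frame entries are real at every complex place: `Im σ_w(dᵢ) = 0`. [cite: Rogawski1990, §3.8 p. 30] -/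
theorem im_embedding_frame_eq_zero (i : Fin 3) : (W.1.embedding (d i)).im = 0 := by
  rw [← Complex.conj_eq_iff_im, ← embedding_cmConjRingHom, hdσ i]

include hdσ hHP in
/-- **`sgn σ_w(det H′) = sgn σ_w(d₀)·σ_w(d₁)·σ_w(d₂)`**: `c(det P)·det H′·det P = d₀ d₁ d₂` and `σ_w(c(det P) det P) = |σ_w det P|² > 0`.
[cite: Rogawski1990, §3.8 Prop. 3.8.1 (d) p. 30] -/
theorem sign_re_embedding_det_of_frame :
    SignType.sign ((W.1.embedding H'.det).re) =
      SignType.sign ((W.1.embedding (d 0)).re) * SignType.sign ((W.1.embedding (d 1)).re) * SignType.sign ((W.1.embedding (d 2)).re) := by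
  have hdet := congrArg Matrix.det hHP
  rw [Matrix.det_mul, Matrix.det_mul, Matrix.det_transpose, Matrix.det_diagonal, Fin.prod_univ_three] at hdet
  have hmapdet : ((P : Matrix (Fin 3) (Fin 3) L).map (cmConjRingHom L)).det = cmConjRingHom L (P : Matrix (Fin 3) (Fin 3) L).det :=
    (RingHom.map_det (cmConjRingHom L) (P : Matrix (Fin 3) (Fin 3) L)).symm
  rw [hmapdet, mul_right_comm] at hdet
  have hP0 : (P : Matrix (Fin 3) (Fin 3) L).det ≠ 0 := by
    rw [← Matrix.GeneralLinearGroup.val_det_apply]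
    exact (Matrix.GeneralLinearGroup.det P).ne_zero
  rw [← sign_re_embedding_norm_mul L W.1.embedding hP0 H'.det, hdet, map_mul, map_mul, Complex.mul_re,
    im_embedding_frame_eq_zero L W hdσ 2, mul_zero, sub_zero, Complex.mul_re, im_embedding_frame_eq_zero L W hdσ 1, mul_zero, sub_zero,
    _root_.sign_mul, _root_.sign_mul]

include he hsplit hnc hχ h1 h2 hdσ hd0 hHP hγP in
/-- **THE PER-PLACE LAW `κ‴_w · e_w = −sgn σ_w(det H′)`**, stated without the Kottwitz-sign vocabulary: `(−sgn σ_w det H′) · κ‴_w(γ_H ⊗ 1, γ₀ ⊗ 1)` is `−1` exactly when the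
`e₁`-eigenplane `W₂(γ₀) ⊗_w ℂ` is DEFINITE (the predicate of socket #10♯ at `w`), `+1` otherwise — in the frame: `−sgn(d₀d₁d₂)·sgn(d₂) = −sgn(d₀d₁)`, and definiteness is
`0 < σ_w(d₀d₁)` (★ `eigenplane_anisotropic_arch_iff`).  The sheet of `γ₀` moves BOTH factors. [cite: Rogawski1990, §8.2 Prop. 8.2.1 proof p. 119 («differs by a sign»); §8.2 p. 117; §14.6 p. 242] [cite: Kottwitz1983, §1] -/
theorem neg_sign_det_mul_archKappaSignAt_eq_ite_of_frame :
    -(SignType.sign ((W.1.embedding H'.det).re) : ℤ) * archKappaSignAt L H' (rationalArch L γH) W (cmRationalToArch L 3 H' γ₀) =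
      if (∀ x : Fin 3 → ℂ,
            Matrix.mulVec (((((γ₀ : unitaryGroup (cmConjRingHom L) H').val : GL (Fin 3) L) : Matrix (Fin 3) (Fin 3) L)).map W.1.embedding - W.1.embedding e₁ • (1 : Matrix (Fin 3) (Fin 3) ℂ)) x = 0 →
            (∑ i, ∑ j, starRingEnd ℂ (x i) * W.1.embedding (H' i j) * x j) = 0 → x = 0)
      then -1 else 1 := by
  rw [eigenplane_anisotropic_arch_iff W.1 γ₀ he hdσ hd0 hHP hγP, archKappaSignAt_singularPair_eq_sign_of_frame L H' γ₀ he hsplit hnc hχ γH h1 h2 W hHP hγP,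
    sign_re_embedding_det_of_frame L H' W hdσ hHP, map_mul, Complex.mul_re, im_embedding_frame_eq_zero L W hdσ 1, mul_zero, sub_zero]
  have hr : ∀ i, (W.1.embedding (d i)).re ≠ 0 := fun i h0 =>
    (map_ne_zero W.1.embedding).2 (hd0 i) (Complex.ext h0 (im_embedding_frame_eq_zero L W hdσ i))
  -- the finite bookkeeping on signs: `−(s₀ s₁ s₂)·s₂ = −s₀ s₁`, and `0 < r₀ r₁ ↔ s₀ = s₁`
  have key : ∀ s₀ s₁ s₂ : SignType, s₀ ≠ 0 → s₁ ≠ 0 → s₂ ≠ 0 →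
      -((s₀ * s₁ * s₂ : SignType) : ℤ) * (s₂ : ℤ) = if s₀ = s₁ then -1 else 1 := by decide
  have hsame : ∀ {r₀ r₁ : ℝ}, r₀ ≠ 0 → r₁ ≠ 0 → (0 < r₀ * r₁ ↔ SignType.sign r₀ = SignType.sign r₁) := by
    intro r₀ r₁ h₀ h₁
    rcases lt_or_gt_of_ne h₀ with h0n | h0p <;> rcases lt_or_gt_of_ne h₁ with h1n | h1p
    · rw [sign_neg h0n, sign_neg h1n]; exact ⟨fun _ => rfl, fun _ => mul_pos_of_neg_of_neg h0n h1n⟩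
    · rw [sign_neg h0n, sign_pos h1p]; exact ⟨fun h => absurd h (not_lt.2 (mul_nonpos_of_nonpos_of_nonneg h0n.le h1p.le)), fun h => absurd h (by decide)⟩
    · rw [sign_pos h0p, sign_neg h1n]; exact ⟨fun h => absurd h (not_lt.2 (mul_nonpos_of_nonneg_of_nonpos h0p.le h1n.le)), fun h => absurd h (by decide)⟩
    · rw [sign_pos h0p, sign_pos h1p]; exact ⟨fun _ => rfl, fun _ => mul_pos h0p h1p⟩
  have hne : ∀ i, SignType.sign ((W.1.embedding (d i)).re) ≠ 0 := fun i h => hr i (sign_eq_zero_iff.1 h)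
  rw [key _ _ _ (hne 0) (hne 1) (hne 2)]
  exact if_congr (hsame (hr 0) (hr 1)).symm rfl rfl

/-! ## §3 The global law at `∞` and the signed closed form of `Δ‴_∞(γ_H ⊗ 1, γ₀ ⊗ 1)` -/

include hherm hanis he hsplit hnc hχ h1 h2 in
omit W in
/-- **THE GLOBAL LAW**: `ε(H′) · Π_w κ‴_w(γ_H ⊗ 1, γ₀ ⊗ 1) = (−1)^{#{w ∣ ∞ : W₂(γ₀) ⊗_w ℂ definite}}` with `ε(H′) = Π_{w complex} (−sgn σ_w(det H′))` — the γ₀-dependent sign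
of socket #10♯ IS the phase of `Δ‴_∞` at the pair up to the constant `ε(H′)` (every infinite place of the CM field `L` is complex, ★ `ncard_setOf_infinitePlace_eq_card_filter`).
[cite: Rogawski1990, §8.2 Prop. 8.2.1 proof p. 119; §14.6 p. 242] [cite: Kottwitz1983, §1] -/
theorem prod_neg_sign_det_mul_prod_archKappaSignAt_eq_neg_one_pow_ncard :
    (∏ W : {w : InfinitePlace L // IsComplex w}, -(SignType.sign ((W.1.embedding H'.det).re) : ℤ)) *
        (∏ W : {w : InfinitePlace L // IsComplex w}, archKappaSignAt L H' (rationalArch L γH) W (cmRationalToArch L 3 H' γ₀)) =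
      (-1) ^ Set.ncard {w : InfinitePlace L |
        (∀ x : Fin 3 → ℂ,
          Matrix.mulVec (((((γ₀ : unitaryGroup (cmConjRingHom L) H').val : GL (Fin 3) L) : Matrix (Fin 3) (Fin 3) L)).map w.embedding - w.embedding e₁ • (1 : Matrix (Fin 3) (Fin 3) ℂ)) x = 0 →
          (∑ i, ∑ j, starRingEnd ℂ (x i) * w.embedding (H' i j) * x j) = 0 → x = 0)} := by
  obtain ⟨P, d, -, -, hdσ, hd0, hHP, hγP⟩ := exists_pinned_diagonal_frame (cmConjRingHom L) (IsCMField.complexConj_apply_apply L)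
    (by norm_num) hherm (det_ne_zero_of_anisotropic_herm L H' hanis) (γ₀ : unitaryGroup (cmConjRingHom L) H') he hsplit hχ
  rw [← Finset.prod_mul_distrib, ncard_setOf_infinitePlace_eq_card_filter]
  rw [Finset.prod_congr rfl fun W _ => neg_sign_det_mul_archKappaSignAt_eq_ite_of_frame L H' γ₀ he hsplit hnc hχ γH h1 h2 W hdσ hd0 hHP hγP,
    Finset.prod_ite, Finset.prod_const, Finset.prod_const_one, mul_one]

include he hsplit hχ h1 h2 in
omit W in
/-- **`Δ‴_∞(γ_H ⊗ 1, γ₀ ⊗ 1) = τ_∞(γ_H ⊗ 1) · D_∞(γ_H ⊗ 1) · Π_w κ‴_w`** at the semiregular pair (★ `archCanonicalDelta_of_isArchNormPair` at ★ `isArchNormPair_of_semiregular`).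
[cite: Rogawski1990, §4.9 p. 55; §14.6 p. 242] -/
theorem archCanonicalDelta_singularPair_eq (μ : HeckeCharacter L) :
    archCanonicalDelta L H' (rationalArch L γH) μ (cmRationalToArch L 3 H' γ₀) =
      archTau L (rationalArch L γH) μ * (archWeylRatio L (rationalArch L γH) : ℂ) *
        ((∏ W : {w : InfinitePlace L // IsComplex w}, archKappaSignAt L H' (rationalArch L γH) W (cmRationalToArch L 3 H' γ₀) : ℤ) : ℂ) :=
  archCanonicalDelta_of_isArchNormPair L H' (rationalArch L γH) μ (isArchNormPair_of_semiregular L H' he hsplit hχ h1 h2)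

include he h1 h2 in
omit W in
/-- **`D_∞(γ_H ⊗ 1) = Π_w |σ_w((e₂ − e₁)²)| > 0`** at the scalar partner (★ `archWeylRatio_rationalArch`, `χ_g(u) = (e₂ − e₁)² ≠ 0` ★ `eval_charpoly_singularPair_ne_zero`).
[cite: Rogawski1990, §4.9 p. 55; Prop. 8.2.1 (a) p. 118 («τ(γ)|A₁(γ)A₂(γ)|»)] -/
theorem archWeylRatio_singularPair_pos : 0 < archWeylRatio L (rationalArch L γH) := by
  rw [archWeylRatio_rationalArch]
  exact Finset.prod_pos fun W _ => norm_pos_iff.2 ((map_ne_zero W.1.embedding).2 (eval_charpoly_singularPair_ne_zero L γH h1 h2 he))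

include hherm hanis he hsplit hχ h1 h2 in
omit W in
/-- **`|τ_∞(γ_H ⊗ 1)| = 1`** in the form `conj τ · τ = 1` for unitary `μ` (`τ ≠ 0` because `Δ‴_∞(γ_H ⊗ 1, γ₀ ⊗ 1) ≠ 0`, ★ `archCanonicalDelta_ne_zero_of_semiregular`; ★ `conj_archTau_mul_archTau_sq`).
[cite: Rogawski1990, §4.9 p. 55 («`|τ(γ)| = 1`»)] -/
theorem conj_archTau_mul_archTau_singularPair (μ : HeckeCharacter L) (hμu : μ.IsUnitary) :
    conj (archTau L (rationalArch L γH) μ) * archTau L (rationalArch L γH) μ = 1 := by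
  have hΔ : archCanonicalDelta L H' (rationalArch L γH) μ (cmRationalToArch L 3 H' γ₀) ≠ 0 :=
    archCanonicalDelta_ne_zero_of_semiregular L H' he hsplit hχ h1 h2 μ hherm hanis
  have hτ : archTau L (rationalArch L γH) μ ≠ 0 := by
    rw [archCanonicalDelta_singularPair_eq L H' γ₀ he hsplit hχ γH h1 h2 μ] at hΔ
    exact left_ne_zero_of_mul (left_ne_zero_of_mul hΔ)
  have h := conj_archTau_mul_archTau_sq L (rationalArch L γH) hμu
  rw [sq, ← mul_assoc] at h
  exact mul_right_cancel₀ hτ (by rw [h, one_mul])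

end Pair

end Summit.HodgeConjecture.HodgeConjecture.Cruxes.H413.K2E4SingularPairArchKappaSign

end
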